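import Literature.AlgebraicGeometry.Resolution.HironakaDirectrixLemmas
import Literature.AlgebraicGeometry.Resolution.RegularLocalRingsNormal
import Mathlib.Algebra.MvPolynomial.Supported
import HarnessLib

/-!
# Initial forms along a permissible centre: `cl_μ(J) ⊆ k[Y_1, …, Y_r]` and `τ(x) ≤ r` (CoP1 (10), Lemma 4.3 (1))

Topic: `Literature/AlgebraicGeometry/Resolution`. [CoP1] = Cossart–Piltant, J. Algebra 320
(2008), proof of Prop. 4.2, p. 8: "let `Y = V(y_1, …, y_r)` be permissible for `E` at `x` (so
`r = 2` or `r = 3`) … let `f ∈ I` with `ord_x f = μ`. By definition of permissibility and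
directrix, we have `F(Y_1, Y_2, Y_3) := in_x f ∈ k(x)[Y_1, …, Y_r] ∩ k(x)[T_x]` (10)", and
Lemma 4.3 (1): "If `τ(x) = 3`, then `Y = {x}`". PROVED at the level of the regular local ring
`R = 𝒪_{X,x}` with regular system of parameters `c` and the centre `P = (c_i : i ∈ S)`
(permissibility along `Y ⊆ {ord = μ}` gives `J ⊆ P^μ`, `le_vanishingIdeal_pow_of_forall_idealOrder_eq`
of `PermissibleBlowup.lean`):

* `initialForms_le_supported` — **(10): if `J ⊆ P^μ` then `cl_μ(J) ⊆ k[Y_i : i ∈ S]`**;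
* `directrix_initialForms_le_span` — hence `T_x ⊆ ⟨Y_i : i ∈ S⟩` and
  `hironakaTauAt_le_card` — **`τ(x) ≤ r = #S`**;
* `eq_univ_of_hironakaTauAt_eq` — **Lemma 4.3 (1), first assertion: if `τ(x) = emb.dim R` then
  `S` is everything, i.e. `P = 𝔪` and `Y = {x}` locally.**

## Sources

* V. Cossart, O. Piltant, J. Algebra 320 (2008), proof of Prop. 4.2 (10) and Lemma 4.3 (1), p. 8.
  [CossartPiltant2008]
-/

noncomputable section

open MvPolynomial IsLocalRing

namespace Literature.AlgebraicGeometry.Resolution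

universe u

section Supported

variable {R : Type u} [CommRing R] {d : ℕ} (c : Fin d → R) (S : Finset (Fin d))

/-- An element of `(c_i : i ∈ S)^μ` is the value of a form of degree `μ` in the variables
`Y_i`, `i ∈ S`, only. [folklore] -/
theorem exists_isHomogeneous_mem_supported_eval_eq {μ : ℕ} {f : R}
    (hf : f ∈ Ideal.span (c '' (S : Set (Fin d))) ^ μ) :
    ∃ F : MvPolynomial (Fin d) R, F.IsHomogeneous μ ∧ F ∈ supported R (S : Set (Fin d)) ∧
      eval c F = f := by
  classical
  have hrange : Set.range (fun s : (S : Set (Fin d)) => c s) = c '' (S : Set (Fin d)) := by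
    ext y
    constructor
    · rintro ⟨⟨i, hi⟩, rfl⟩
      exact ⟨i, hi, rfl⟩
    · rintro ⟨i, hi, rfl⟩
      exact ⟨⟨i, hi⟩, rfl⟩
  rw [← hrange] at hf
  obtain ⟨H, hH, hHf⟩ := exists_isHomogeneous_of_mem_span_pow (fun s : (S : Set (Fin d)) => c s) μ hf
  refine ⟨rename Subtype.val H, hH.rename_isHomogeneous, ?_, ?_⟩
  · rw [mem_supported]
    intro i hi
    obtain ⟨s, -, rfl⟩ := Finset.mem_image.mp (vars_rename _ _ (Finset.mem_coe.mp hi))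
    exact s.2
  · rw [eval_rename]
    exact hHf

end Supported

section Regular

variable {R : Type u} [CommRing R] [IsRegularLocalRing R] {d : ℕ}
  (hd : (maximalIdeal R).spanFinrank = d) (c : Fin d → R)
  (hc : Ideal.span (Set.range c) = maximalIdeal R) (S : Finset (Fin d))

include hd hc in
/-- **[CoP1] (10): `in_x f ∈ k(x)[Y_1, …, Y_r]`** — if `J ⊆ P^μ` for the centre ideal
`P = (c_i : i ∈ S)` generated by part of a regular system of parameters, then every element of
`cl_μ(J)` is a polynomial in the `Y_i`, `i ∈ S`: an `f ∈ J` is `F(c)` for a form `F` of degree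
`μ` in these variables, and initial forms do not depend on the form chosen
(`map_residue_eq_of_eval_eq`). [cite: CossartPiltant2008, proof of Prop. 4.2, (10)] -/
theorem initialForms_le_supported {J : Ideal R} {μ : ℕ}
    (hJ : J ≤ Ideal.span (c '' (S : Set (Fin d))) ^ μ) :
    (initialForms c J μ : Set (MvPolynomial (Fin d) (ResidueField R))) ⊆
      supported (ResidueField R) (S : Set (Fin d)) := by
  rintro G ⟨F', hF', hF'J, rfl⟩
  by_cases hG0 : MvPolynomial.map (residue R) F' = 0
  · rw [hG0]
    exact Subalgebra.zero_mem _
  obtain ⟨F, hF, hFS, hFf⟩ := exists_isHomogeneous_mem_supported_eval_eq c S (hJ hF'J)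
  -- `F̄ ≠ 0`: otherwise `F(c) = F'(c) ∈ 𝔪^{μ+1}` and `F̄' = 0`
  have hF0 : MvPolynomial.map (residue R) F ≠ 0 := by
    intro h0
    apply hG0
    refine map_residue_eq_zero_of_eval_mem_pow_succ hd c hc hF' ?_
    rw [← hFf]
    exact eval_mem_pow_succ_of_map_residue_eq_zero c hc hF h0
  have heq := (map_residue_eq_of_eval_eq hd c hc hF hF' hF0 hG0 hFf).2
  rw [← heq, SetLike.mem_coe, mem_supported]
  exact (Finset.coe_subset.mpr (vars_map F (residue R))).trans (mem_supported.mp hFS)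

/-- The coordinate subalgebra `k[Y_i : i ∈ S]` is `k[T']` for `T' = ⟨e_i^* : i ∈ S⟩`. [folklore] -/
theorem supported_le_linearFormsSubalgebra (k : Type u) [Field k] :
    supported k (S : Set (Fin d)) ≤ linearFormsSubalgebra k
      (Submodule.span k ((fun i => (LinearMap.proj i : Module.Dual k (Fin d → k))) '' (S : Set (Fin d)))) := by
  rw [supported_eq_adjoin_X]
  refine Algebra.adjoin_mono ?_
  rintro _ ⟨i, hi, rfl⟩
  refine ⟨LinearMap.proj i, Submodule.subset_span ⟨i, hi, rfl⟩, ?_⟩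
  exact linearFormPoly_proj k i

include hd hc in
/-- Hence **`T_x ⊆ ⟨Y_i : i ∈ S⟩`** (the directrix of `cl_μ(J)` lies in the span of the
coordinate forms of the centre). [cite: CossartPiltant2008, proof of Prop. 4.2, (10)] -/
theorem directrix_initialForms_le_span {J : Ideal R} {μ : ℕ}
    (hJ : J ≤ Ideal.span (c '' (S : Set (Fin d))) ^ μ) :
    directrix (ResidueField R) (initialForms c J μ : Set _) ≤
      Submodule.span (ResidueField R)
        ((fun i => (LinearMap.proj i : Module.Dual (ResidueField R) (Fin d → ResidueField R))) ''
          (S : Set (Fin d))) :=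
  directrix_le_of_subset _ ((initialForms_le_supported hd c hc S hJ).trans
    (supported_le_linearFormsSubalgebra S (ResidueField R)))

include hd hc in
/-- **`τ(x) ≤ r`**: the invariant `τ` of `cl_μ(J)` is at most the number of parameters
generating the centre ideal `P ⊇` … with `J ⊆ P^μ` ([CoP1]: `T_x ⊆ ⟨Y_1, …, Y_r⟩`).
[cite: CossartPiltant2008, proof of Prop. 4.2, (10)] -/
theorem hironakaTauAt_le_card {J : Ideal R} {μ : ℕ}
    (hJ : J ≤ Ideal.span (c '' (S : Set (Fin d))) ^ μ) : hironakaTauAt c J μ ≤ S.card := by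
  classical
  refine (Submodule.finrank_mono (directrix_initialForms_le_span hd c hc S hJ)).trans ?_
  have himg : ((fun i => (LinearMap.proj i : Module.Dual (ResidueField R) (Fin d → ResidueField R))) ''
      (S : Set (Fin d))) = ↑(S.image fun i =>
        (LinearMap.proj i : Module.Dual (ResidueField R) (Fin d → ResidueField R))) := by
    rw [Finset.coe_image]
  rw [himg]
  exact (finrank_span_finset_le_card _).trans Finset.card_image_le

include hd hc in
/-- **[CoP1] Lemma 4.3 (1), first assertion: "If `τ(x) = 3`, then `Y = {x}`"** — at the level of
the local ring: if `J ⊆ P^μ` for `P = (c_i : i ∈ S)` and `τ(cl_μ J)` equals the embedding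
dimension `d`, then `S` is the whole index set, i.e. `P = 𝔪` (the permissible centre through
`x` is the closed point). [cite: CossartPiltant2008, Lemma 4.3 (1)] -/
theorem eq_univ_of_hironakaTauAt_eq {J : Ideal R} {μ : ℕ}
    (hJ : J ≤ Ideal.span (c '' (S : Set (Fin d))) ^ μ) (hτ : hironakaTauAt c J μ = d) :
    S = Finset.univ := by
  apply Finset.eq_univ_of_card
  rw [Fintype.card_fin]
  refine le_antisymm (S.card_le_univ.trans (by rw [Fintype.card_fin])) ?_
  have h := hironakaTauAt_le_card hd c hc S hJ
  rw [hτ] at h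
  exact h

include hd hc in
/-- The same with the conclusion `P = 𝔪`. [cite: CossartPiltant2008, Lemma 4.3 (1)] -/
theorem span_image_eq_maximalIdeal_of_hironakaTauAt_eq {J : Ideal R} {μ : ℕ}
    (hJ : J ≤ Ideal.span (c '' (S : Set (Fin d))) ^ μ) (hτ : hironakaTauAt c J μ = d) :
    Ideal.span (c '' (S : Set (Fin d))) = maximalIdeal R := by
  rw [eq_univ_of_hironakaTauAt_eq hd c hc S hJ hτ, Finset.coe_univ, Set.image_univ, hc]

end Regular

end Literature.AlgebraicGeometry.Resolution

end
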